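import Summits.HubbardSuperconductivity.HubbardSuperconductivity.Theorems.AnisotropyChordKnnRatioBounds
import Summits.HubbardSuperconductivity.HubbardSuperconductivity.Theorems.AnisotropyChordKnnCertificate
import Summits.HubbardSuperconductivity.HubbardSuperconductivity.Theorems.AnisotropyChordKnnAssembly

/-!
# Route `AnisotropyChord` / H0 rotor rung, K_{n,n} sibling of XY-LM₀: a DATA-FREE rational checker for the budget
# condition (S_M) on a whole anisotropy interval `η ∈ (0, η₀]`
(prover seat `hubbard-h0-rotor-p1` g16; kernel-evaluable companion of `…KnnRatioBounds`)

`ratioCheck n M η₀ : Bool` computes, over `ℚ`, the continued-fraction ratio majorants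
`T_0 = cU_0/(p_top − p_0)`, `T_{k+1} = cU_{k+1}/(p_top − p_{k+1} − cU_k T_k)` of the block `P_M(η₀)` (`ratioTQ`), checks that all
brackets are positive, and that the Horner value `H_{m′−1}(d, dcU, cU, T)` is at most the budget `d_{2s−2}(M)`.  By
`budgetCondition_of_ratioBounds_of_le` a passing check proves (S_M) for EVERY real `η` with `0 < η ≤ η₀`
(`budgetCondition_of_ratioCheck`): one rational evaluation per `(n, M)`, no certificate data, and the perturbative corner
`η → 0` (`Δ → 1`) is covered automatically.
-/

set_option linter.dupNamespace false
set_option autoImplicit false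

open Finset Matrix

namespace Summit.HubbardSuperconductivity.HubbardSuperconductivity.Theorems.AnisotropyChord.Knn

/-! ## `ℚ` mirrors -/

/-- `cU_k` over `ℚ`. [folklore] -/
def cUKQ (n : ℕ) (M : ℤ) (η : ℚ) (k : ℕ) : ℚ := η / 8 * (bSqQ n M (lev n M k) + bSqQ n M (lev n M k + 1))

/-- cast of `cUKQ`. [folklore] -/
theorem cast_cUKQ (n : ℕ) (M : ℤ) (η : ℚ) (k : ℕ) : ((cUKQ n M η k : ℚ) : ℝ) = cUK n M (η : ℝ) k := by
  unfold cUKQ cUK; push_cast; rw [cast_bSqQ, cast_bSqQ]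

/-- `d_k` over `ℚ`. [folklore] -/
def dKQ (n M : ℕ) (η : ℚ) (k : ℕ) : ℚ := pKQ n (M : ℤ) η (k + shift n M) - pKQ n ((M : ℤ) + 1) η k

/-- cast of `dKQ`. [folklore] -/
theorem cast_dKQ (n M : ℕ) (η : ℚ) (k : ℕ) : ((dKQ n M η k : ℚ) : ℝ) = dK n M (η : ℝ) k := by
  unfold dKQ dK; push_cast; rw [cast_pKQ, cast_pKQ]

/-- `x′_J` over `ℚ`. [folklore] -/
def xLevQ (J M : ℕ) : ℚ := ((J : ℚ) + 1) ^ 2 - ((M : ℚ) + 1) ^ 2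

/-- `y′_J` over `ℚ`. [folklore] -/
def yLevQ (J M : ℕ) : ℚ := ((J : ℚ) + 2) ^ 2 - ((M : ℚ) + 1) ^ 2

/-- `dcU_k` over `ℚ`. [folklore] -/
def dcUKQ (n M : ℕ) (η : ℚ) (k : ℕ) : ℚ :=
  if lev n (M : ℤ) k + 2 ≤ n then
    η / 4 * (2 * (M : ℚ) + 1) * ((betaSqQ n (lev n (M : ℤ) k) + betaSqQ n (lev n (M : ℤ) k + 1)) / 2)
      * ((xLevQ (lev n (M : ℤ) k) M + yLevQ (lev n (M : ℤ) k) M) ^ 2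
          / (4 * xLevQ (lev n (M : ℤ) k) M * yLevQ (lev n (M : ℤ) k) M))
  else 0

/-- cast of `dcUKQ`. [folklore] -/
theorem cast_dcUKQ (n M : ℕ) (η : ℚ) (k : ℕ) : ((dcUKQ n M η k : ℚ) : ℝ) = dcUK n M (η : ℝ) k := by
  unfold dcUKQ dcUK xLevQ yLevQ xLev yLev
  split_ifs <;> push_cast <;> simp [cast_betaSqQ]

/-- the ratio majorants `T_k` over `ℚ` (bottom-up continued fraction with `λ` replaced by `p_top`). [folklore] -/
def ratioTQ (n : ℕ) (M : ℤ) (η : ℚ) : ℕ → ℚ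
  | 0 => cUKQ n M η 0 / (pKQ n M η (numLevels n M - 1) - pKQ n M η 0)
  | k + 1 => cUKQ n M η (k + 1)
      / (pKQ n M η (numLevels n M - 1) - pKQ n M η (k + 1) - cUKQ n M η k * ratioTQ n M η k)

/-- the brackets `p_top − p_k − [k ≥ 1] cU_{k−1} T_{k−1}` over `ℚ`. [folklore] -/
def bracketQ (n : ℕ) (M : ℤ) (η : ℚ) (k : ℕ) : ℚ :=
  pKQ n M η (numLevels n M - 1) - pKQ n M η k - (if k = 0 then 0 else cUKQ n M η (k - 1) * ratioTQ n M η (k - 1))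

/-- `T_k = cU_k / bracket_k`. [folklore] -/
theorem ratioTQ_eq (n : ℕ) (M : ℤ) (η : ℚ) (k : ℕ) : ratioTQ n M η k = cUKQ n M η k / bracketQ n M η k := by
  cases k with
  | zero => simp [ratioTQ, bracketQ]
  | succ k => simp [ratioTQ, bracketQ]

/-- the real ratio bounds read off the `ℚ` recursion. [folklore] -/
noncomputable def ratioT (n : ℕ) (M : ℤ) (η : ℚ) (k : ℕ) : ℝ := ((ratioTQ n M η k : ℚ) : ℝ)

/-- cast of `bracketQ` is the real `bracket` with `T = ratioT`. [folklore] -/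
theorem cast_bracketQ (n : ℕ) (M : ℤ) (η : ℚ) (k : ℕ) :
    ((bracketQ n M η k : ℚ) : ℝ) = bracket (numLevels n M) (pK n M (η : ℝ)) (cUK n M (η : ℝ)) (ratioT n M η) k := by
  unfold bracketQ bracket ratioT
  split_ifs <;> push_cast <;> simp [cast_pKQ, cast_cUKQ]

/-- Horner accumulator over `ℚ`. [folklore] -/
def hornerQ (d dcU cU T : ℕ → ℚ) (s : ℕ) : ℕ → ℚ
  | 0 => d 0 + (if s = 1 then cU 0 * T 0 else 0)
  | k + 1 => d (k + 1) + 2 * dcU (k + s) * T (k + s) + T (k + s) ^ 2 * hornerQ d dcU cU T s k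

/-- cast of `hornerQ`. [folklore] -/
theorem cast_hornerQ (d dcU cU T : ℕ → ℚ) (s k : ℕ) :
    ((hornerQ d dcU cU T s k : ℚ) : ℝ)
      = horner (fun j => ((d j : ℚ) : ℝ)) (fun j => ((dcU j : ℚ) : ℝ)) (fun j => ((cU j : ℚ) : ℝ))
          (fun j => ((T j : ℚ) : ℝ)) s k := by
  induction k with
  | zero => simp only [hornerQ, horner_zero]; split_ifs <;> push_cast <;> ring
  | succ k ih => simp only [hornerQ, horner_succ]; push_cast; rw [ih]

/-! ## The checker and its soundness -/

/-- **the data-free checker:** all brackets of `P_M(η)` positive and the Horner value `≤ budget`. [folklore] -/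
def ratioCheck (n M : ℕ) (η : ℚ) : Bool :=
  ((List.range (numLevels n (M : ℤ) - 1)).all fun k => decide (0 < bracketQ n (M : ℤ) η k))
  && decide (hornerQ (dKQ n M η) (dcUKQ n M η) (cUKQ n (M : ℤ) η) (ratioTQ n (M : ℤ) η) (shift n M)
        (numLevels n ((M : ℤ) + 1) - 1) ≤ budgetQ n M η)

/-- **SOUNDNESS + MONOTONE COVERAGE: a passing check at `η₀` proves (S_M) for every real `0 < η ≤ η₀`.** [folklore] -/
theorem budgetCondition_of_ratioCheck {n M : ℕ} {η₀ : ℚ} (h : ratioCheck n M η₀ = true) (hM : M + 4 ≤ n)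
    {η : ℝ} (hη : 0 < η) (hle : η ≤ ((η₀ : ℚ) : ℝ)) : BudgetCondition n M η := by
  unfold ratioCheck at h
  rw [Bool.and_eq_true, List.all_eq_true, decide_eq_true_eq] at h
  obtain ⟨hbr, hH⟩ := h
  have hbr' : ∀ k, k + 1 < numLevels n (M : ℤ) →
      0 < bracket (numLevels n (M : ℤ)) (pK n (M : ℤ) (η₀ : ℝ)) (cUK n (M : ℤ) (η₀ : ℝ)) (ratioT n (M : ℤ) η₀) k := by
    intro k hk
    have := hbr k (List.mem_range.mpr (by omega))
    rw [decide_eq_true_eq] at this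
    rw [← cast_bracketQ]; exact_mod_cast this
  apply budgetCondition_of_ratioBounds_of_le hM hη hle (ratioT n (M : ℤ) η₀) hbr'
  · intro k hk
    have hb := hbr' k hk
    have hbq : bracketQ n (M : ℤ) η₀ k ≠ 0 := by
      intro h0; rw [← cast_bracketQ, h0] at hb; simp at hb
    have : cUKQ n (M : ℤ) η₀ k = ratioTQ n (M : ℤ) η₀ k * bracketQ n (M : ℤ) η₀ k := by
      rw [ratioTQ_eq, div_mul_cancel₀ _ hbq]
    rw [← cast_cUKQ, this]; unfold ratioT; push_cast; rw [cast_bracketQ]; rfl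
  · have hH' : ((hornerQ (dKQ n M η₀) (dcUKQ n M η₀) (cUKQ n (M : ℤ) η₀) (ratioTQ n (M : ℤ) η₀) (shift n M)
        (numLevels n ((M : ℤ) + 1) - 1) : ℚ) : ℝ) ≤ ((budgetQ n M η₀ : ℚ) : ℝ) := by exact_mod_cast hH
    rw [cast_hornerQ, cast_budgetQ] at hH'
    have e1 : (fun j => ((dKQ n M η₀ j : ℚ) : ℝ)) = dK n M (η₀ : ℝ) := funext fun j => cast_dKQ n M η₀ j
    have e2 : (fun j => ((dcUKQ n M η₀ j : ℚ) : ℝ)) = dcUK n M (η₀ : ℝ) := funext fun j => cast_dcUKQ n M η₀ j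
    have e3 : (fun j => ((cUKQ n (M : ℤ) η₀ j : ℚ) : ℝ)) = cUK n (M : ℤ) (η₀ : ℝ) := funext fun j => cast_cUKQ n _ η₀ j
    have e4 : (fun j => ((ratioTQ n (M : ℤ) η₀ j : ℚ) : ℝ)) = ratioT n (M : ℤ) η₀ := rfl
    rw [e1, e2, e3, e4] at hH'
    exact hH'

/-- **table check:** `ratioCheck n M η₀` for all `lo ≤ n ≤ hi` and `M + 4 ≤ n`. [folklore] -/
def ratioCheckAll (η : ℚ) (lo hi : ℕ) : Bool :=
  (List.range (hi + 1)).all fun n => decide (n < lo) || (List.range (n - 3)).all fun M => ratioCheck n M η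

/-- soundness of the table check: (S_M) for all `lo ≤ n ≤ hi`, `M + 4 ≤ n`, `0 < η ≤ η₀`. [folklore] -/
theorem budgetCondition_of_ratioCheckAll {η₀ : ℚ} {lo hi : ℕ} (h : ratioCheckAll η₀ lo hi = true) {n M : ℕ}
    (hlo : lo ≤ n) (hhi : n ≤ hi) (hM : M + 4 ≤ n) {η : ℝ} (hη : 0 < η) (hle : η ≤ ((η₀ : ℚ) : ℝ)) :
    BudgetCondition n M η := by
  unfold ratioCheckAll at h
  rw [List.all_eq_true] at h
  have hn := h n (List.mem_range.mpr (by omega))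
  rw [Bool.or_eq_true, decide_eq_true_eq, List.all_eq_true] at hn
  rcases hn with hn | hn
  · omega
  exact budgetCondition_of_ratioCheck (hn M (List.mem_range.mpr (by omega))) hM hη hle

/-- **`XYLiebMattisKnn n Δ` for `lo ≤ n ≤ hi` on the whole range `1 − η₀ ≤ Δ < 1` from a passing table check.** [folklore] -/
theorem xyLiebMattisKnn_of_ratioCheckAll {η₀ : ℚ} {lo hi : ℕ} (h : ratioCheckAll η₀ lo hi = true) {n : ℕ}
    (hlo : lo ≤ n) (hhi : n ≤ hi) {Δ : ℝ} (hΔ : Δ < 1) (hle : 1 - Δ ≤ ((η₀ : ℚ) : ℝ)) : XYLiebMattisKnn n Δ :=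
  xyLiebMattisKnn_of_budgets hΔ fun _ hM => budgetCondition_of_ratioCheckAll h hlo hhi hM (by linarith) hle

end Summit.HubbardSuperconductivity.HubbardSuperconductivity.Theorems.AnisotropyChord.Knn
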